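import Summits.BirchSwinnertonDyer.BirchSwinnertonDyer.Theorems.AlignedTransportAtTwoMainConjectureOfRankZeroBSDAtTwoPointFieldCarrierReflectionPair
import HarnessLib

/-!
# Route `AlignedTransportAtTwo`, crux C2 `MainConjectureOfRankZeroBSDAtTwo` (stmt-BirchSwinnertonDyer-22298):
# THE REFLECTION-PAIR RELATION OF THE PFμ⁺ CARRIER — `e_n(ℚ(β_j, √−Δ_W)) = e_n(ℚ(β_j, √−1)) + e_n(ℚ(√−Δ_W))` AT EVERY LAYER

HONEST FRAMING. WIDTH-5 attached prover seat `bsd-line-att-p3` g35 on line `birth`; `--supports` stmt-BirchSwinnertonDyer-22298 (helper), closes nothing;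
BSD is NOT proved; crux C2, its verdict and every registered stub untouched. THEOREMS ONLY (no `def`, no named fact, no `sorry`).

WHAT. With the `D₆` data `σ, τ, z` of `…PointFieldCarrierReflectionPair` (`⟨τ⟩ = Fix ℚ(β_j,i)`, `⟨σ,τ⟩ = Fix ℚ(i)`, `⟨τz⟩ = Fix ℚ(β_j,w)`, `⟨σ,τz⟩ = Fix ℚ(w)`,
`w = iδ`, `w² = −Δ_W`), this seat's Literature lemma `classNumberPExp_reflectionPair_exact` (att-p4 g30's exact `S₃` relation run for both reflection classes of
`S₃ × C₂`) gives along any `ℤ₂`-extension `κ` of `ℚ` with `κ ∘ res` onto for the fields involved: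
  ★★ `classNumberPExp_reflectionPair_sup_adjoin_I`: **`e_n(κ|_{ℚ(β_j,i)}) + e_n(κ|_{ℚ(w)}) = e_n(κ|_{ℚ(β_j,w)}) + e_n(κ|_{ℚ(i)})`**, every `n`;
  ★★ `classNumberPExp_adjoin_xT_sup_adjoin_w_eq` (`e_n(ℚ(i)) = 0`, Weber): **`e_n(ℚ(β_j, √−Δ_W)) = e_n(ℚ(β_j, √−1)) + e_n(ℚ(√−Δ_W))`**;
  ★★ `classicalLambda_reflectionPair_sup_adjoin_I` / `…_eq_of_isOrdinaryAt`: `μ₂(ℚ(β_j,i)) = 0 ⟹ μ₂(ℚ(β_j,√−Δ_W)) = 0` and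
  **`λ₂(ℚ(β_j,√−Δ_W)) = λ₂(ℚ(β_j,i)) + λ₂(ℚ(√−Δ_W))`** (the last term is the imaginary/real quadratic `ℚ(√−Δ_W)`, `μ₂ = 0` by genus theory; on `Δ_W > 0`
  it is the Ferrero–Kida invariant).  So the two CM sextics of the `Δ_W > 0` quarter carry the same `μ₂` (att-p3 g34 memo §3.3, successor (d) made exact).

References: [CaputoNuccio2020] Prop. 3.12, Rem. 3.13; [Washington1997] §13.1, §13.3 Thm. 13.13, Prop. 13.22; [Kida1979], [Ferrero1980] (λ₂ of imaginary quadratics);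
tree: this seat's `IwasawaTheory.SymmetricThreeTowerExactCentral`, `…PointFieldCarrierReflectionPair`, `…PointFieldCarrierDSixExact`, `IwasawaTheory.ClassNumberPExpZeroAdjoinSqrtNegOne`.
-/

set_option linter.dupNamespace false
set_option autoImplicit false

noncomputable section

open scoped Classical NumberField IntermediateField

namespace Summit.BirchSwinnertonDyer.BirchSwinnertonDyer.Theorems.AlignedTransportAtTwoPointFieldCarrierReflectionPairExact

open NumberField Polynomial WeierstrassCurve IntermediateField Field
  Literature.NumberTheory.EllipticCurves Literature.NumberTheory.EllipticCurves.Greenberg1999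
  Literature.NumberTheory.EllipticCurves.DokchitserDokchitser2012
  Literature.NumberTheory.EllipticCurves.ZpExtension Literature.NumberTheory.GaloisRepresentations
  Literature.NumberTheory.IwasawaTheory Literature.NumberTheory.NumberFields
  Summit.BirchSwinnertonDyer.BirchSwinnertonDyer.Theorems.AlignedTransportAtTwoFineRoad.DivisionCubic
  Summit.BirchSwinnertonDyer.BirchSwinnertonDyer.Theorems.AlignedTransportAtTwoFineRoad.TowerImageDelta
  Summit.BirchSwinnertonDyer.BirchSwinnertonDyer.Theorems.AlignedTransportAtTwoCubicClosureParity
  Summit.BirchSwinnertonDyer.BirchSwinnertonDyer.Theorems.AlignedTransportAtTwoSexticTowerGrowth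
  Summit.BirchSwinnertonDyer.BirchSwinnertonDyer.Theorems.AlignedTransportAtTwoSexticNormRelationDescent
  Summit.BirchSwinnertonDyer.BirchSwinnertonDyer.Theorems.AlignedTransportAtTwoSexticNormRelationDescentSignFree
  Summit.BirchSwinnertonDyer.BirchSwinnertonDyer.Theorems.AlignedTransportAtTwoSexticNormRelationDescentSignFreeAdjoinI
  Summit.BirchSwinnertonDyer.BirchSwinnertonDyer.Theorems.AlignedTransportAtTwoSexticLambdaKuroda
  Summit.BirchSwinnertonDyer.BirchSwinnertonDyer.Theorems.AlignedTransportAtTwoPointFieldCarrierCM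
  Summit.BirchSwinnertonDyer.BirchSwinnertonDyer.Theorems.AlignedTransportAtTwoPointFieldCarrierCMIff
  Summit.BirchSwinnertonDyer.BirchSwinnertonDyer.Theorems.AlignedTransportAtTwoResolventMuUnconditional
  Summit.BirchSwinnertonDyer.BirchSwinnertonDyer.Theorems.AlignedTransportAtTwoPointFieldCarrierGalois
  Summit.BirchSwinnertonDyer.BirchSwinnertonDyer.Theorems.AlignedTransportAtTwoPointFieldCarrierDSixExact
  Summit.BirchSwinnertonDyer.BirchSwinnertonDyer.Theorems.AlignedTransportAtTwoPointFieldCarrierReflectionPair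

variable (W : WeierstrassCurve ℚ) [W.IsElliptic]

/-! ## §1 The reflection-pair relation along a restricted tower -/

set_option maxHeartbeats 800000 in
set_option synthInstance.maxHeartbeats 80000 in
/-- ★★ **`e_n(κ|_{ℚ(β_j,i)}) + e_n(κ|_{ℚ(w)}) = e_n(κ|_{ℚ(β_j,w)}) + e_n(κ|_{ℚ(i)})` at every layer** (`w = i·δ`, `w² = −Δ_W`; `W(ℚ)[2] = 0`,
`Δ_W, −Δ_W ∉ ℚ²`, `i² = −1`; `κ` a `ℤ₂`-extension of `ℚ` with `κ ∘ res` onto for `M` and the four fields): the reflection-pair relation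
`classNumberPExp_reflectionPair_exact` on the `D₆` data of the carrier, fixed fields carried to the models in `ℚ̄`. [cite: CaputoNuccio2020, Prop. 3.12 and Rem. 3.13]
[cite: Washington1997, §13.1] -/
theorem classNumberPExp_reflectionPair_sup_adjoin_I (ht : ∀ x : ℚ, ¬ HasRationalTwoTorsionX W x) (hsq : ¬ IsSquare W.Δ)
    (hnegΔ : ¬ IsSquare (-W.Δ)) {i : AlgebraicClosure ℚ} (hi : i ^ 2 = -1) (j : Fin 3) (κ : ZpExtension ℚ 2)
    [NumberField ↥(W.divisionField 2 ⊔ IntermediateField.adjoin ℚ ({i} : Set (AlgebraicClosure ℚ)))] [NumberField ↥(IntermediateField.adjoin ℚ ({i} : Set (AlgebraicClosure ℚ)))] [NumberField ↥(ℚ⟮xT W two_ne_zero j⟯ ⊔ IntermediateField.adjoin ℚ ({i} : Set (AlgebraicClosure ℚ)))] [NumberField ↥ℚ⟮i * (4 * delta W two_ne_zero)⟯] [NumberField ↥(ℚ⟮xT W two_ne_zero j⟯ ⊔ ℚ⟮i * (4 * delta W two_ne_zero)⟯)]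
    (hM : Function.Surjective (κ.toContinuousMonoidHom.comp (absGaloisRestrict ℚ ↥(W.divisionField 2 ⊔ IntermediateField.adjoin ℚ ({i} : Set (AlgebraicClosure ℚ))))))
    (hQ : Function.Surjective (κ.toContinuousMonoidHom.comp (absGaloisRestrict ℚ ↥(IntermediateField.adjoin ℚ ({i} : Set (AlgebraicClosure ℚ))))))
    (hP : Function.Surjective (κ.toContinuousMonoidHom.comp (absGaloisRestrict ℚ ↥(ℚ⟮xT W two_ne_zero j⟯ ⊔ IntermediateField.adjoin ℚ ({i} : Set (AlgebraicClosure ℚ))))))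
    (hQ2 : Function.Surjective (κ.toContinuousMonoidHom.comp (absGaloisRestrict ℚ ↥ℚ⟮i * (4 * delta W two_ne_zero)⟯)))
    (hP2 : Function.Surjective (κ.toContinuousMonoidHom.comp (absGaloisRestrict ℚ ↥(ℚ⟮xT W two_ne_zero j⟯ ⊔ ℚ⟮i * (4 * delta W two_ne_zero)⟯))))
    (n : ℕ) :
    classNumberPExp (κ.restrict ↥(ℚ⟮xT W two_ne_zero j⟯ ⊔ IntermediateField.adjoin ℚ ({i} : Set (AlgebraicClosure ℚ))) hP) n + classNumberPExp (κ.restrict ↥ℚ⟮i * (4 * delta W two_ne_zero)⟯ hQ2) n =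
      classNumberPExp (κ.restrict ↥(ℚ⟮xT W two_ne_zero j⟯ ⊔ ℚ⟮i * (4 * delta W two_ne_zero)⟯) hP2) n + classNumberPExp (κ.restrict ↥(IntermediateField.adjoin ℚ ({i} : Set (AlgebraicClosure ℚ))) hQ) n := by
  haveI hfd : FiniteDimensional ℚ ↥(W.divisionField 2 ⊔ IntermediateField.adjoin ℚ ({i} : Set (AlgebraicClosure ℚ))) := finiteDimensional_divisionField_two_sup_adjoin_I W hi
  haveI hgal : IsGalois ℚ ↥(W.divisionField 2 ⊔ IntermediateField.adjoin ℚ ({i} : Set (AlgebraicClosure ℚ))) := isGalois_divisionField_two_sup_adjoin_I W hi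
  haveI : ∀ E : IntermediateField ℚ ↥(W.divisionField 2 ⊔ IntermediateField.adjoin ℚ ({i} : Set (AlgebraicClosure ℚ))), NumberField ↥E := fun E ↦ NumberField.mk
  obtain ⟨σ, τ, z, hσN, hτH, hσ3, hτ2, hrel, hgen, hz2, hzσ, hzτ, hτzH, hgen2⟩ := exists_dSix_data_sup_adjoin_I W ht hsq hnegΔ hi j
  have hRf := surjective_comp_absGaloisRestrict_of_tower κ ↥(fixedField (Subgroup.zpowers σ)) ↥(W.divisionField 2 ⊔ IntermediateField.adjoin ℚ ({i} : Set (AlgebraicClosure ℚ))) hM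
  have hKf := surjective_comp_absGaloisRestrict_of_tower κ ↥(fixedField (Subgroup.zpowers τ)) ↥(W.divisionField 2 ⊔ IntermediateField.adjoin ℚ ({i} : Set (AlgebraicClosure ℚ))) hM
  have hkf := surjective_comp_absGaloisRestrict_of_tower κ ↥(fixedField (Subgroup.closure {σ, τ})) ↥(W.divisionField 2 ⊔ IntermediateField.adjoin ℚ ({i} : Set (AlgebraicClosure ℚ))) hM
  have hK'f := surjective_comp_absGaloisRestrict_of_tower κ ↥(fixedField (Subgroup.zpowers (τ * z))) ↥(W.divisionField 2 ⊔ IntermediateField.adjoin ℚ ({i} : Set (AlgebraicClosure ℚ))) hM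
  have hk'f := surjective_comp_absGaloisRestrict_of_tower κ ↥(fixedField (Subgroup.closure {σ, τ * z})) ↥(W.divisionField 2 ⊔ IntermediateField.adjoin ℚ ({i} : Set (AlgebraicClosure ℚ))) hM
  have main := classNumberPExp_reflectionPair_exact κ ↥(W.divisionField 2 ⊔ IntermediateField.adjoin ℚ ({i} : Set (AlgebraicClosure ℚ))) hM hσ3 hτ2 hrel hz2 hzσ hzτ hRf hKf hkf hK'f hk'f n
  have eK : fixedField (Subgroup.zpowers τ) = IntermediateField.restrict (adjoin_xT_sup_adjoin_I_le_sup W i j) := by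
    rw [hτH]
    exact @IsGalois.fixedField_fixingSubgroup ℚ _ ↥(W.divisionField 2 ⊔ IntermediateField.adjoin ℚ ({i} : Set (AlgebraicClosure ℚ))) _ _ _ hfd hgal
  have ek : fixedField (Subgroup.closure {σ, τ}) = IntermediateField.restrict (adjoin_I_le_sup W i) := by
    rw [hgen]
    exact @IsGalois.fixedField_fixingSubgroup ℚ _ ↥(W.divisionField 2 ⊔ IntermediateField.adjoin ℚ ({i} : Set (AlgebraicClosure ℚ))) _ _ _ hfd hgal
  have eK' : fixedField (Subgroup.zpowers (τ * z)) = IntermediateField.restrict (adjoin_xT_sup_adjoin_w_le_sup W i j) := by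
    rw [hτzH]
    exact @IsGalois.fixedField_fixingSubgroup ℚ _ ↥(W.divisionField 2 ⊔ IntermediateField.adjoin ℚ ({i} : Set (AlgebraicClosure ℚ))) _ _ _ hfd hgal
  have ek' : fixedField (Subgroup.closure {σ, τ * z}) = IntermediateField.restrict (adjoin_w_le_sup W i) := by
    rw [hgen2]
    exact @IsGalois.fixedField_fixingSubgroup ℚ _ ↥(W.divisionField 2 ⊔ IntermediateField.adjoin ℚ ({i} : Set (AlgebraicClosure ℚ))) _ _ _ hfd hgal
  have cK := classNumberPExp_restrict_eq_of_algEquiv κ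
    ((IntermediateField.equivOfEq eK).trans (IntermediateField.restrict_algEquiv (adjoin_xT_sup_adjoin_I_le_sup W i j)).symm) hKf hP n
  have ck := classNumberPExp_restrict_eq_of_algEquiv κ
    ((IntermediateField.equivOfEq ek).trans (IntermediateField.restrict_algEquiv (adjoin_I_le_sup W i)).symm) hkf hQ n
  have cK' := classNumberPExp_restrict_eq_of_algEquiv κ
    ((IntermediateField.equivOfEq eK').trans (IntermediateField.restrict_algEquiv (adjoin_xT_sup_adjoin_w_le_sup W i j)).symm) hK'f hP2 n
  have ck' := classNumberPExp_restrict_eq_of_algEquiv κ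
    ((IntermediateField.equivOfEq ek').trans (IntermediateField.restrict_algEquiv (adjoin_w_le_sup W i)).symm) hk'f hQ2 n
  rw [cK, ck, cK', ck'] at main
  exact main

/-- ★★ **`e_n(ℚ(β_j, √−Δ_W)) = e_n(ℚ(β_j, √−1)) + e_n(ℚ(√−Δ_W))` at every layer** (restricted form; `e_n(ℚ(i)) = 0` folded in, Weber): the two CM
sextics above the cubic `ℚ(β_j)` differ, along the cyclotomic `ℤ₂`-tower, exactly by the `2`-class numbers of the quadratic field `ℚ(√−Δ_W)`.
[cite: CaputoNuccio2020, Prop. 3.12] [cite: Washington1997, §13.1, Prop. 13.22] -/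
theorem classNumberPExp_adjoin_xT_sup_adjoin_w_eq (ht : ∀ x : ℚ, ¬ HasRationalTwoTorsionX W x) (hsq : ¬ IsSquare W.Δ)
    (hnegΔ : ¬ IsSquare (-W.Δ)) {i : AlgebraicClosure ℚ} (hi : i ^ 2 = -1) (j : Fin 3) (κ : ZpExtension ℚ 2)
    [NumberField ↥(W.divisionField 2 ⊔ IntermediateField.adjoin ℚ ({i} : Set (AlgebraicClosure ℚ)))] [NumberField ↥(IntermediateField.adjoin ℚ ({i} : Set (AlgebraicClosure ℚ)))] [NumberField ↥(ℚ⟮xT W two_ne_zero j⟯ ⊔ IntermediateField.adjoin ℚ ({i} : Set (AlgebraicClosure ℚ)))] [NumberField ↥ℚ⟮i * (4 * delta W two_ne_zero)⟯] [NumberField ↥(ℚ⟮xT W two_ne_zero j⟯ ⊔ ℚ⟮i * (4 * delta W two_ne_zero)⟯)]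
    (hM : Function.Surjective (κ.toContinuousMonoidHom.comp (absGaloisRestrict ℚ ↥(W.divisionField 2 ⊔ IntermediateField.adjoin ℚ ({i} : Set (AlgebraicClosure ℚ))))))
    (hQ : Function.Surjective (κ.toContinuousMonoidHom.comp (absGaloisRestrict ℚ ↥(IntermediateField.adjoin ℚ ({i} : Set (AlgebraicClosure ℚ))))))
    (hP : Function.Surjective (κ.toContinuousMonoidHom.comp (absGaloisRestrict ℚ ↥(ℚ⟮xT W two_ne_zero j⟯ ⊔ IntermediateField.adjoin ℚ ({i} : Set (AlgebraicClosure ℚ))))))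
    (hQ2 : Function.Surjective (κ.toContinuousMonoidHom.comp (absGaloisRestrict ℚ ↥ℚ⟮i * (4 * delta W two_ne_zero)⟯)))
    (hP2 : Function.Surjective (κ.toContinuousMonoidHom.comp (absGaloisRestrict ℚ ↥(ℚ⟮xT W two_ne_zero j⟯ ⊔ ℚ⟮i * (4 * delta W two_ne_zero)⟯))))
    (n : ℕ) :
    classNumberPExp (κ.restrict ↥(ℚ⟮xT W two_ne_zero j⟯ ⊔ ℚ⟮i * (4 * delta W two_ne_zero)⟯) hP2) n = classNumberPExp (κ.restrict ↥(ℚ⟮xT W two_ne_zero j⟯ ⊔ IntermediateField.adjoin ℚ ({i} : Set (AlgebraicClosure ℚ))) hP) n + classNumberPExp (κ.restrict ↥ℚ⟮i * (4 * delta W two_ne_zero)⟯ hQ2) n := by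
  have h := classNumberPExp_reflectionPair_sup_adjoin_I W ht hsq hnegΔ hi j κ hM hQ hP hQ2 hP2 n
  have h0 := classNumberPExp_adjoin_sqrt_neg_one_eq_zero hi (κ.restrict ↥(IntermediateField.adjoin ℚ ({i} : Set (AlgebraicClosure ℚ))) hQ) n
  omega

/-! ## §2 Iwasawa invariants -/

/-- ★★ **`μ₂ = 0` on `ℚ(β_j, √−1)` ⟹ `μ₂ = 0` on `ℚ(β_j, √−Δ_W)`, with `λ₂(ℚ(β_j,√−Δ_W)) = λ₂(ℚ(β_j,i)) + λ₂(ℚ(√−Δ_W))` EXACTLY** (restricted form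
along the cyclotomic `κ` of `ℚ`; `ℚ(√−Δ_W)` quadratic, `μ₂ = 0` fact-free by att-p3 g34's `classicalMuVanishes_of_finrank_eq_two`).
[cite: CaputoNuccio2020, Prop. 3.12] [cite: Washington1997, §13.3 Thm. 13.13] -/
theorem classicalLambda_reflectionPair_sup_adjoin_I (ht : ∀ x : ℚ, ¬ HasRationalTwoTorsionX W x) (hsq : ¬ IsSquare W.Δ)
    (hnegΔ : ¬ IsSquare (-W.Δ)) {i : AlgebraicClosure ℚ} (hi : i ^ 2 = -1) (j : Fin 3) (κ : ZpExtension ℚ 2) (hκ : κ.IsCyclotomic)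
    [NumberField ↥(W.divisionField 2 ⊔ IntermediateField.adjoin ℚ ({i} : Set (AlgebraicClosure ℚ)))] [NumberField ↥(IntermediateField.adjoin ℚ ({i} : Set (AlgebraicClosure ℚ)))] [NumberField ↥(ℚ⟮xT W two_ne_zero j⟯ ⊔ IntermediateField.adjoin ℚ ({i} : Set (AlgebraicClosure ℚ)))] [NumberField ↥ℚ⟮i * (4 * delta W two_ne_zero)⟯] [NumberField ↥(ℚ⟮xT W two_ne_zero j⟯ ⊔ ℚ⟮i * (4 * delta W two_ne_zero)⟯)]
    (hM : Function.Surjective (κ.toContinuousMonoidHom.comp (absGaloisRestrict ℚ ↥(W.divisionField 2 ⊔ IntermediateField.adjoin ℚ ({i} : Set (AlgebraicClosure ℚ))))))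
    (hQ : Function.Surjective (κ.toContinuousMonoidHom.comp (absGaloisRestrict ℚ ↥(IntermediateField.adjoin ℚ ({i} : Set (AlgebraicClosure ℚ))))))
    (hP : Function.Surjective (κ.toContinuousMonoidHom.comp (absGaloisRestrict ℚ ↥(ℚ⟮xT W two_ne_zero j⟯ ⊔ IntermediateField.adjoin ℚ ({i} : Set (AlgebraicClosure ℚ))))))
    (hQ2 : Function.Surjective (κ.toContinuousMonoidHom.comp (absGaloisRestrict ℚ ↥ℚ⟮i * (4 * delta W two_ne_zero)⟯)))
    (hP2 : Function.Surjective (κ.toContinuousMonoidHom.comp (absGaloisRestrict ℚ ↥(ℚ⟮xT W two_ne_zero j⟯ ⊔ ℚ⟮i * (4 * delta W two_ne_zero)⟯))))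
    (hμP : ClassicalMuVanishes (κ.restrict ↥(ℚ⟮xT W two_ne_zero j⟯ ⊔ IntermediateField.adjoin ℚ ({i} : Set (AlgebraicClosure ℚ))) hP)) :
    ClassicalMuVanishes (κ.restrict ↥(ℚ⟮xT W two_ne_zero j⟯ ⊔ ℚ⟮i * (4 * delta W two_ne_zero)⟯) hP2) ∧
      classicalLambda (κ.restrict ↥(ℚ⟮xT W two_ne_zero j⟯ ⊔ ℚ⟮i * (4 * delta W two_ne_zero)⟯) hP2) = classicalLambda (κ.restrict ↥(ℚ⟮xT W two_ne_zero j⟯ ⊔ IntermediateField.adjoin ℚ ({i} : Set (AlgebraicClosure ℚ))) hP) + classicalLambda (κ.restrict ↥ℚ⟮i * (4 * delta W two_ne_zero)⟯ hQ2) := by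
  have hμQ2 : ClassicalMuVanishes (κ.restrict ↥ℚ⟮i * (4 * delta W two_ne_zero)⟯ hQ2) :=
    classicalMuVanishes_of_finrank_eq_two ↥ℚ⟮i * (4 * delta W two_ne_zero)⟯ (finrank_adjoin_w W hnegΔ hi) _ (isCyclotomic_restrict κ hκ _ hQ2)
  obtain ⟨νP, nP, hgP⟩ := classicalLambda_spec _ hμP
  obtain ⟨νQ, nQ, hgQ⟩ := classicalLambda_spec _ hμQ2
  set lP := classicalLambda (κ.restrict ↥(ℚ⟮xT W two_ne_zero j⟯ ⊔ IntermediateField.adjoin ℚ ({i} : Set (AlgebraicClosure ℚ))) hP) with hlP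
  set lQ := classicalLambda (κ.restrict ↥ℚ⟮i * (4 * delta W two_ne_zero)⟯ hQ2) with hlQ
  have hid := fun n ↦ classNumberPExp_adjoin_xT_sup_adjoin_w_eq W ht hsq hnegΔ hi j κ hM hQ hP hQ2 hP2 n
  set N := max nP nQ with hN
  have hg : ∀ n, N ≤ n → (classNumberPExp (κ.restrict ↥(ℚ⟮xT W two_ne_zero j⟯ ⊔ ℚ⟮i * (4 * delta W two_ne_zero)⟯) hP2) n : ℤ) = ((lP + lQ : ℕ) : ℤ) * n + (νP + νQ) := by
    intro n hn
    have h1 := hgP n (le_trans (le_max_left _ _) hn)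
    have h2 := hgQ n (le_trans (le_max_right _ _) hn)
    have h3 : (classNumberPExp (κ.restrict ↥(ℚ⟮xT W two_ne_zero j⟯ ⊔ ℚ⟮i * (4 * delta W two_ne_zero)⟯) hP2) n : ℤ) =
        classNumberPExp (κ.restrict ↥(ℚ⟮xT W two_ne_zero j⟯ ⊔ IntermediateField.adjoin ℚ ({i} : Set (AlgebraicClosure ℚ))) hP) n + classNumberPExp (κ.restrict ↥ℚ⟮i * (4 * delta W two_ne_zero)⟯ hQ2) n := by
      exact_mod_cast hid n
    rw [h3, h1, h2]
    push_cast
    ring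
  exact ⟨⟨lP + lQ, νP + νQ, N, hg⟩, (eq_classicalLambda_of_growth _ hg).symm⟩

/-- ★★ **On C2's binders, intrinsic form.**  `W` globally minimal, good ordinary at `2`, no rational `2`-torsion abscissa, `Δ_W, −Δ_W ∉ ℚ²`, `i² = −1`;
`κP, κP2, κQ2` ANY cyclotomic `ℤ₂`-extensions of `ℚ(β_j, i)`, `ℚ(β_j, w)`, `ℚ(w)` (`w = iδ`, `w² = −Δ_W`).  If `μ₂ = 0` for the cyclotomic `ℤ₂`-extensions of the
CM point field `ℚ(β_j, i)`, then **`μ₂(ℚ(β_j, √−Δ_W)) = 0` and `λ(κP2) = λ(κP) + λ(κQ2)`** — the two CM sextics of att-p3 g34's price list carry the same `μ₂`.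
[cite: CaputoNuccio2020, Prop. 3.12] [cite: Washington1997, §13.3] -/
theorem classicalLambda_reflectionPair_eq_of_isOrdinaryAt [W.IsGloballyMinimal] (hord : IsOrdinaryAt W 2)
    (ht : ∀ x : ℚ, ¬ HasRationalTwoTorsionX W x) (hsq : ¬ IsSquare W.Δ) (hnegΔ : ¬ IsSquare (-W.Δ)) {i : AlgebraicClosure ℚ} (hi : i ^ 2 = -1)
    (j : Fin 3)
    [NumberField ↥(W.divisionField 2 ⊔ IntermediateField.adjoin ℚ ({i} : Set (AlgebraicClosure ℚ)))] [NumberField ↥(ℚ⟮xT W two_ne_zero j⟯ ⊔ IntermediateField.adjoin ℚ ({i} : Set (AlgebraicClosure ℚ)))] [NumberField ↥ℚ⟮i * (4 * delta W two_ne_zero)⟯] [NumberField ↥(ℚ⟮xT W two_ne_zero j⟯ ⊔ ℚ⟮i * (4 * delta W two_ne_zero)⟯)]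
    (hμP : ∀ κP : ZpExtension ↥(ℚ⟮xT W two_ne_zero j⟯ ⊔ IntermediateField.adjoin ℚ ({i} : Set (AlgebraicClosure ℚ))) 2, κP.IsCyclotomic → ClassicalMuVanishes κP)
    (κP : ZpExtension ↥(ℚ⟮xT W two_ne_zero j⟯ ⊔ IntermediateField.adjoin ℚ ({i} : Set (AlgebraicClosure ℚ))) 2) (hκP : κP.IsCyclotomic)
    (κP2 : ZpExtension ↥(ℚ⟮xT W two_ne_zero j⟯ ⊔ ℚ⟮i * (4 * delta W two_ne_zero)⟯) 2) (hκP2 : κP2.IsCyclotomic)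
    (κQ2 : ZpExtension ↥ℚ⟮i * (4 * delta W two_ne_zero)⟯ 2) (hκQ2 : κQ2.IsCyclotomic) :
    ClassicalMuVanishes κP2 ∧ classicalLambda κP2 = classicalLambda κP + classicalLambda κQ2 := by
  haveI : Fact (Nat.Prime 2) := ⟨Nat.prime_two⟩
  have h2Δ := not_isSquare_two_mul_Δ_of_isOrdinaryAt W hord
  have hm2Δ := not_isSquare_neg_two_mul_Δ_of_isOrdinaryAt W hord
  have hint : IsIntegral ℚ i := by
    refine ⟨X ^ 2 + 1, monic_X_pow_add_C _ two_ne_zero, ?_⟩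
    simp [hi]
  haveI : FiniteDimensional ℚ ↥(IntermediateField.adjoin ℚ ({i} : Set (AlgebraicClosure ℚ))) := IntermediateField.adjoin.finiteDimensional hint
  haveI : NumberField ↥(IntermediateField.adjoin ℚ ({i} : Set (AlgebraicClosure ℚ))) := NumberField.mk
  obtain ⟨κ, hκ⟩ := exists_cyclotomicZpExtension_holds ℚ 2
  have hM := surjective_gal_restrict_sup_adjoin_I W ht hsq h2Δ hm2Δ hi κ hκ
  letI aQ : Algebra ↥(IntermediateField.adjoin ℚ ({i} : Set (AlgebraicClosure ℚ))) ↥(W.divisionField 2 ⊔ IntermediateField.adjoin ℚ ({i} : Set (AlgebraicClosure ℚ))) := (IntermediateField.inclusion (adjoin_I_le_sup W i)).toRingHom.toAlgebra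
  haveI : IsScalarTower ℚ ↥(IntermediateField.adjoin ℚ ({i} : Set (AlgebraicClosure ℚ))) ↥(W.divisionField 2 ⊔ IntermediateField.adjoin ℚ ({i} : Set (AlgebraicClosure ℚ))) := IsScalarTower.of_algebraMap_eq fun _ ↦ rfl
  letI aP : Algebra ↥(ℚ⟮xT W two_ne_zero j⟯ ⊔ IntermediateField.adjoin ℚ ({i} : Set (AlgebraicClosure ℚ))) ↥(W.divisionField 2 ⊔ IntermediateField.adjoin ℚ ({i} : Set (AlgebraicClosure ℚ))) := (IntermediateField.inclusion (adjoin_xT_sup_adjoin_I_le_sup W i j)).toRingHom.toAlgebra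
  haveI : IsScalarTower ℚ ↥(ℚ⟮xT W two_ne_zero j⟯ ⊔ IntermediateField.adjoin ℚ ({i} : Set (AlgebraicClosure ℚ))) ↥(W.divisionField 2 ⊔ IntermediateField.adjoin ℚ ({i} : Set (AlgebraicClosure ℚ))) := IsScalarTower.of_algebraMap_eq fun _ ↦ rfl
  letI aQ2 : Algebra ↥ℚ⟮i * (4 * delta W two_ne_zero)⟯ ↥(W.divisionField 2 ⊔ IntermediateField.adjoin ℚ ({i} : Set (AlgebraicClosure ℚ))) := (IntermediateField.inclusion (adjoin_w_le_sup W i)).toRingHom.toAlgebra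
  haveI : IsScalarTower ℚ ↥ℚ⟮i * (4 * delta W two_ne_zero)⟯ ↥(W.divisionField 2 ⊔ IntermediateField.adjoin ℚ ({i} : Set (AlgebraicClosure ℚ))) := IsScalarTower.of_algebraMap_eq fun _ ↦ rfl
  letI aP2 : Algebra ↥(ℚ⟮xT W two_ne_zero j⟯ ⊔ ℚ⟮i * (4 * delta W two_ne_zero)⟯) ↥(W.divisionField 2 ⊔ IntermediateField.adjoin ℚ ({i} : Set (AlgebraicClosure ℚ))) := (IntermediateField.inclusion (adjoin_xT_sup_adjoin_w_le_sup W i j)).toRingHom.toAlgebra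
  haveI : IsScalarTower ℚ ↥(ℚ⟮xT W two_ne_zero j⟯ ⊔ ℚ⟮i * (4 * delta W two_ne_zero)⟯) ↥(W.divisionField 2 ⊔ IntermediateField.adjoin ℚ ({i} : Set (AlgebraicClosure ℚ))) := IsScalarTower.of_algebraMap_eq fun _ ↦ rfl
  have hQ := surjective_comp_absGaloisRestrict_of_tower κ ↥(IntermediateField.adjoin ℚ ({i} : Set (AlgebraicClosure ℚ))) ↥(W.divisionField 2 ⊔ IntermediateField.adjoin ℚ ({i} : Set (AlgebraicClosure ℚ))) hM
  have hP := surjective_comp_absGaloisRestrict_of_tower κ ↥(ℚ⟮xT W two_ne_zero j⟯ ⊔ IntermediateField.adjoin ℚ ({i} : Set (AlgebraicClosure ℚ))) ↥(W.divisionField 2 ⊔ IntermediateField.adjoin ℚ ({i} : Set (AlgebraicClosure ℚ))) hM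
  have hQ2 := surjective_comp_absGaloisRestrict_of_tower κ ↥ℚ⟮i * (4 * delta W two_ne_zero)⟯ ↥(W.divisionField 2 ⊔ IntermediateField.adjoin ℚ ({i} : Set (AlgebraicClosure ℚ))) hM
  have hP2 := surjective_comp_absGaloisRestrict_of_tower κ ↥(ℚ⟮xT W two_ne_zero j⟯ ⊔ ℚ⟮i * (4 * delta W two_ne_zero)⟯) ↥(W.divisionField 2 ⊔ IntermediateField.adjoin ℚ ({i} : Set (AlgebraicClosure ℚ))) hM
  have main := classicalLambda_reflectionPair_sup_adjoin_I W ht hsq hnegΔ hi j κ hκ hM hQ hP hQ2 hP2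
    (hμP _ (isCyclotomic_restrict κ hκ _ hP))
  refine ⟨(classicalMuVanishes_iff_of_isCyclotomic _ _ (isCyclotomic_restrict κ hκ _ hP2) hκP2).mp main.1, ?_⟩
  rw [classicalLambda_eq_of_isCyclotomic κP2 _ hκP2 (isCyclotomic_restrict κ hκ _ hP2),
    classicalLambda_eq_of_isCyclotomic κP _ hκP (isCyclotomic_restrict κ hκ _ hP),
    classicalLambda_eq_of_isCyclotomic κQ2 _ hκQ2 (isCyclotomic_restrict κ hκ _ hQ2)]
  exact main.2


/-! ## §3 The reflection-pair identity on C2's binders, for ANY cyclotomic towers (appended, same seat) -/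

/-- ★★ **`e_n(ℚ(β_j, √−Δ_W)) = e_n(ℚ(β_j, √−1)) + e_n(ℚ(√−Δ_W))` for every `n` and ANY cyclotomic `ℤ₂`-extensions of the three fields** (`W` globally
minimal, good ordinary at `2`, `W(ℚ)[2] = 0`, `Δ_W, −Δ_W ∉ ℚ²`, `i² = −1`, `w = iδ`): §1 along the cyclotomic tower of `ℚ`, transported by
`classNumberPExp_eq_of_isCyclotomic`.  The -data form of the reflection pair. [cite: CaputoNuccio2020, Prop. 3.12] [cite: Washington1997, §13.1, Prop. 13.22] -/
theorem classNumberPExp_adjoin_xT_sup_adjoin_w_eq_of_isOrdinaryAt [W.IsGloballyMinimal] (hord : IsOrdinaryAt W 2)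
    (ht : ∀ x : ℚ, ¬ HasRationalTwoTorsionX W x) (hsq : ¬ IsSquare W.Δ) (hnegΔ : ¬ IsSquare (-W.Δ)) {i : AlgebraicClosure ℚ} (hi : i ^ 2 = -1)
    (j : Fin 3)
    [NumberField ↥(W.divisionField 2 ⊔ IntermediateField.adjoin ℚ ({i} : Set (AlgebraicClosure ℚ)))] [NumberField ↥(ℚ⟮xT W two_ne_zero j⟯ ⊔ IntermediateField.adjoin ℚ ({i} : Set (AlgebraicClosure ℚ)))] [NumberField ↥ℚ⟮i * (4 * delta W two_ne_zero)⟯] [NumberField ↥(ℚ⟮xT W two_ne_zero j⟯ ⊔ ℚ⟮i * (4 * delta W two_ne_zero)⟯)]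
    (κP : ZpExtension ↥(ℚ⟮xT W two_ne_zero j⟯ ⊔ IntermediateField.adjoin ℚ ({i} : Set (AlgebraicClosure ℚ))) 2) (hκP : κP.IsCyclotomic)
    (κP2 : ZpExtension ↥(ℚ⟮xT W two_ne_zero j⟯ ⊔ ℚ⟮i * (4 * delta W two_ne_zero)⟯) 2) (hκP2 : κP2.IsCyclotomic)
    (κQ2 : ZpExtension ↥ℚ⟮i * (4 * delta W two_ne_zero)⟯ 2) (hκQ2 : κQ2.IsCyclotomic) (n : ℕ) :
    classNumberPExp κP2 n = classNumberPExp κP n + classNumberPExp κQ2 n := by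
  haveI : Fact (Nat.Prime 2) := ⟨Nat.prime_two⟩
  have h2Δ := not_isSquare_two_mul_Δ_of_isOrdinaryAt W hord
  have hm2Δ := not_isSquare_neg_two_mul_Δ_of_isOrdinaryAt W hord
  have hint : IsIntegral ℚ i := by
    refine ⟨X ^ 2 + 1, monic_X_pow_add_C _ two_ne_zero, ?_⟩
    simp [hi]
  haveI : FiniteDimensional ℚ ↥(IntermediateField.adjoin ℚ ({i} : Set (AlgebraicClosure ℚ))) := IntermediateField.adjoin.finiteDimensional hint
  haveI : NumberField ↥(IntermediateField.adjoin ℚ ({i} : Set (AlgebraicClosure ℚ))) := NumberField.mk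
  obtain ⟨κ, hκ⟩ := exists_cyclotomicZpExtension_holds ℚ 2
  have hM := surjective_gal_restrict_sup_adjoin_I W ht hsq h2Δ hm2Δ hi κ hκ
  letI aQ : Algebra ↥(IntermediateField.adjoin ℚ ({i} : Set (AlgebraicClosure ℚ))) ↥(W.divisionField 2 ⊔ IntermediateField.adjoin ℚ ({i} : Set (AlgebraicClosure ℚ))) := (IntermediateField.inclusion (adjoin_I_le_sup W i)).toRingHom.toAlgebra
  haveI : IsScalarTower ℚ ↥(IntermediateField.adjoin ℚ ({i} : Set (AlgebraicClosure ℚ))) ↥(W.divisionField 2 ⊔ IntermediateField.adjoin ℚ ({i} : Set (AlgebraicClosure ℚ))) := IsScalarTower.of_algebraMap_eq fun _ ↦ rfl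
  letI aP : Algebra ↥(ℚ⟮xT W two_ne_zero j⟯ ⊔ IntermediateField.adjoin ℚ ({i} : Set (AlgebraicClosure ℚ))) ↥(W.divisionField 2 ⊔ IntermediateField.adjoin ℚ ({i} : Set (AlgebraicClosure ℚ))) := (IntermediateField.inclusion (adjoin_xT_sup_adjoin_I_le_sup W i j)).toRingHom.toAlgebra
  haveI : IsScalarTower ℚ ↥(ℚ⟮xT W two_ne_zero j⟯ ⊔ IntermediateField.adjoin ℚ ({i} : Set (AlgebraicClosure ℚ))) ↥(W.divisionField 2 ⊔ IntermediateField.adjoin ℚ ({i} : Set (AlgebraicClosure ℚ))) := IsScalarTower.of_algebraMap_eq fun _ ↦ rfl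
  letI aQ2 : Algebra ↥ℚ⟮i * (4 * delta W two_ne_zero)⟯ ↥(W.divisionField 2 ⊔ IntermediateField.adjoin ℚ ({i} : Set (AlgebraicClosure ℚ))) := (IntermediateField.inclusion (adjoin_w_le_sup W i)).toRingHom.toAlgebra
  haveI : IsScalarTower ℚ ↥ℚ⟮i * (4 * delta W two_ne_zero)⟯ ↥(W.divisionField 2 ⊔ IntermediateField.adjoin ℚ ({i} : Set (AlgebraicClosure ℚ))) := IsScalarTower.of_algebraMap_eq fun _ ↦ rfl
  letI aP2 : Algebra ↥(ℚ⟮xT W two_ne_zero j⟯ ⊔ ℚ⟮i * (4 * delta W two_ne_zero)⟯) ↥(W.divisionField 2 ⊔ IntermediateField.adjoin ℚ ({i} : Set (AlgebraicClosure ℚ))) := (IntermediateField.inclusion (adjoin_xT_sup_adjoin_w_le_sup W i j)).toRingHom.toAlgebra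
  haveI : IsScalarTower ℚ ↥(ℚ⟮xT W two_ne_zero j⟯ ⊔ ℚ⟮i * (4 * delta W two_ne_zero)⟯) ↥(W.divisionField 2 ⊔ IntermediateField.adjoin ℚ ({i} : Set (AlgebraicClosure ℚ))) := IsScalarTower.of_algebraMap_eq fun _ ↦ rfl
  have hQ := surjective_comp_absGaloisRestrict_of_tower κ ↥(IntermediateField.adjoin ℚ ({i} : Set (AlgebraicClosure ℚ))) ↥(W.divisionField 2 ⊔ IntermediateField.adjoin ℚ ({i} : Set (AlgebraicClosure ℚ))) hM
  have hP := surjective_comp_absGaloisRestrict_of_tower κ ↥(ℚ⟮xT W two_ne_zero j⟯ ⊔ IntermediateField.adjoin ℚ ({i} : Set (AlgebraicClosure ℚ))) ↥(W.divisionField 2 ⊔ IntermediateField.adjoin ℚ ({i} : Set (AlgebraicClosure ℚ))) hM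
  have hQ2 := surjective_comp_absGaloisRestrict_of_tower κ ↥ℚ⟮i * (4 * delta W two_ne_zero)⟯ ↥(W.divisionField 2 ⊔ IntermediateField.adjoin ℚ ({i} : Set (AlgebraicClosure ℚ))) hM
  have hP2 := surjective_comp_absGaloisRestrict_of_tower κ ↥(ℚ⟮xT W two_ne_zero j⟯ ⊔ ℚ⟮i * (4 * delta W two_ne_zero)⟯) ↥(W.divisionField 2 ⊔ IntermediateField.adjoin ℚ ({i} : Set (AlgebraicClosure ℚ))) hM
  have main := classNumberPExp_adjoin_xT_sup_adjoin_w_eq W ht hsq hnegΔ hi j κ hM hQ hP hQ2 hP2 n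
  rw [classNumberPExp_eq_of_isCyclotomic κP2 _ hκP2 (isCyclotomic_restrict κ hκ _ hP2) n,
    classNumberPExp_eq_of_isCyclotomic κP _ hκP (isCyclotomic_restrict κ hκ _ hP) n,
    classNumberPExp_eq_of_isCyclotomic κQ2 _ hκQ2 (isCyclotomic_restrict κ hκ _ hQ2) n]
  exact main

end Summit.BirchSwinnertonDyer.BirchSwinnertonDyer.Theorems.AlignedTransportAtTwoPointFieldCarrierReflectionPairExact

end
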